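import Mathlib
import Summits.ValiantsHypothesis.ValiantsHypothesis.Theorems.BorderApolarityToricFixedPointsCellRetractionAux2

/-!
# Border apolarity, support item `BorelFixedBorderApolarity` — weight filtrations under lowering maps

Route `ValiantsHypothesis/BorderApolarity`, support item `stmt-ValiantsHypothesis-5781`, helper
file (descent algebra, part A).  Fix an integer weight `μ` on the variables, the filtration pieces
`F_{≥ν}` / `F_{<ν}` (polynomials all of whose monomials have `μ`-weight `≥ ν` / `< ν`, the
submodules `restrictSupport`), and a linear map `Φ` which is **lowering**: for every `D` with
weights `≤ ν`, `Φ D - D` has weights `< ν` (the substitutions by unipotent elements of the group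
`H₀` for an anti-dominant `μ`).  For a `μ`-GRADED finite-dimensional subspace `W` and injective `Φ`:

* `bfba_rank_le` — `dim (Φ W ∩ F_{≥ν}) ≤ dim (W ∩ F_{≥ν})` for every `ν` (if `Φ w ∈ F_{≥ν}` and
  all weights of `w` are `< ν` then `w = 0`: compare top-weight coefficients);
* `bfba_map_eq_of_rank_eq` — if equality holds for every `ν` then `Φ W = W`.

These two facts drive the descent which replaces the Borel fixed point theorem in the proof of
the support item: translating a graded limit by a unipotent element that moves it strictly lowers
the rank profile `ν ↦ dim (· ∩ F_{≥ν})`.  Folklore linear algebra.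
-/

open MvPolynomial
open scoped BigOperators

namespace Summit.ValiantsHypothesis.ValiantsHypothesis.Theorems.BorderApolarityBorelFixedBorderApolarity

set_option linter.dupNamespace false

open Summit.ValiantsHypothesis.ValiantsHypothesis.Theorems.BorderApolarityToricFixedPoints (cr_sum_comp)

variable {σ : Type} (μ : σ → ℤ)

/-! ## The filtration pieces -/

/-- Membership in `F_{≥ν}`. [folklore] -/
theorem bfba_mem_Fge {ν : ℤ} {D : MvPolynomial σ ℂ} :
    D ∈ restrictSupport ℂ {e : σ →₀ ℕ | ν ≤ Finsupp.weight μ e} ↔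
      ∀ e ∈ D.support, ν ≤ Finsupp.weight μ e := by
  rw [mem_restrictSupport_iff]
  exact Iff.rfl

/-- Membership in `F_{<ν}`. [folklore] -/
theorem bfba_mem_Flt {ν : ℤ} {D : MvPolynomial σ ℂ} :
    D ∈ restrictSupport ℂ {e : σ →₀ ℕ | Finsupp.weight μ e < ν} ↔
      ∀ e ∈ D.support, Finsupp.weight μ e < ν := by
  rw [mem_restrictSupport_iff]
  exact Iff.rfl

/-- `F_{≥ν} ∩ F_{<ν} = 0`. [folklore] -/
theorem bfba_eq_zero_of_mem_Fge_Flt {ν : ℤ} {D : MvPolynomial σ ℂ}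
    (h1 : D ∈ restrictSupport ℂ {e : σ →₀ ℕ | ν ≤ Finsupp.weight μ e})
    (h2 : D ∈ restrictSupport ℂ {e : σ →₀ ℕ | Finsupp.weight μ e < ν}) : D = 0 := by
  rw [bfba_mem_Fge] at h1
  rw [bfba_mem_Flt] at h2
  by_contra hD
  obtain ⟨e, he⟩ := Finset.nonempty_of_ne_empty (mt support_eq_empty.1 hD)
  have := h1 e he
  have := h2 e he
  omega

/-- A weight component `π_ν' D` lies in `F_{≥ν}` when `ν ≤ ν'`. [folklore] -/
theorem bfba_comp_mem_Fge {ν ν' : ℤ} (h : ν ≤ ν') (D : MvPolynomial σ ℂ) :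
    weightedHomogeneousComponent μ ν' D ∈ restrictSupport ℂ {e : σ →₀ ℕ | ν ≤ Finsupp.weight μ e} := by
  rw [bfba_mem_Fge]
  intro e he
  rw [mem_support_iff, coeff_weightedHomogeneousComponent] at he
  split_ifs at he with hw
  · rw [hw]; exact h
  · exact absurd rfl he

/-- A weight component `π_ν' D` lies in `F_{<ν}` when `ν' < ν`. [folklore] -/
theorem bfba_comp_mem_Flt {ν ν' : ℤ} (h : ν' < ν) (D : MvPolynomial σ ℂ) :
    weightedHomogeneousComponent μ ν' D ∈ restrictSupport ℂ {e : σ →₀ ℕ | Finsupp.weight μ e < ν} := by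
  rw [bfba_mem_Flt]
  intro e he
  rw [mem_support_iff, coeff_weightedHomogeneousComponent] at he
  split_ifs at he with hw
  · rw [hw]; exact h
  · exact absurd rfl he

/-! ## Graded subspaces split along the filtration -/

/-- **Graded splitting.**  If `W` is `μ`-graded then every `w ∈ W` is `a + b` with `a ∈ W ∩ F_{≥ν}`
and `b ∈ W ∩ F_{<ν}` (group the weight components of `w`). [folklore] -/
theorem bfba_graded_split [DecidableEq σ] (W : Submodule ℂ (MvPolynomial σ ℂ))
    (hgr : ∀ D ∈ W, ∀ ν : ℤ, weightedHomogeneousComponent μ ν D ∈ W) (ν : ℤ) {w : MvPolynomial σ ℂ}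
    (hw : w ∈ W) :
    ∃ a b : MvPolynomial σ ℂ, a ∈ W ∧ a ∈ restrictSupport ℂ {e : σ →₀ ℕ | ν ≤ Finsupp.weight μ e} ∧
      b ∈ W ∧ b ∈ restrictSupport ℂ {e : σ →₀ ℕ | Finsupp.weight μ e < ν} ∧ w = a + b := by
  set T := w.support.image (Finsupp.weight μ) with hT
  refine ⟨∑ ν' ∈ T.filter (fun ν' => ν ≤ ν'), weightedHomogeneousComponent μ ν' w,
    ∑ ν' ∈ T.filter (fun ν' => ¬ ν ≤ ν'), weightedHomogeneousComponent μ ν' w, ?_, ?_, ?_, ?_, ?_⟩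
  · exact W.sum_mem fun ν' _ => hgr w hw ν'
  · exact Submodule.sum_mem _ fun ν' hν' => bfba_comp_mem_Fge μ (Finset.mem_filter.1 hν').2 w
  · exact W.sum_mem fun ν' _ => hgr w hw ν'
  · exact Submodule.sum_mem _ fun ν' hν' =>
      bfba_comp_mem_Flt μ (not_le.1 (Finset.mem_filter.1 hν').2) w
  · rw [Finset.sum_filter_add_sum_filter_not, hT, cr_sum_comp (μ := μ) w]

/-- **Dimension splitting for graded subspaces**:
`dim (W ∩ F_{≥ν}) + dim (W ∩ F_{<ν}) = dim W`. [folklore] -/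
theorem bfba_finrank_graded_split [DecidableEq σ] (W : Submodule ℂ (MvPolynomial σ ℂ))
    [FiniteDimensional ℂ W]
    (hgr : ∀ D ∈ W, ∀ ν : ℤ, weightedHomogeneousComponent μ ν D ∈ W) (ν : ℤ) :
    Module.finrank ℂ ↥(W ⊓ restrictSupport ℂ {e : σ →₀ ℕ | ν ≤ Finsupp.weight μ e}) +
      Module.finrank ℂ ↥(W ⊓ restrictSupport ℂ {e : σ →₀ ℕ | Finsupp.weight μ e < ν}) =
      Module.finrank ℂ W := by
  set S₁ := W ⊓ restrictSupport ℂ {e : σ →₀ ℕ | ν ≤ Finsupp.weight μ e} with hS₁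
  set S₂ := W ⊓ restrictSupport ℂ {e : σ →₀ ℕ | Finsupp.weight μ e < ν} with hS₂
  have hsup : S₁ ⊔ S₂ = W := by
    apply le_antisymm (sup_le inf_le_left inf_le_left)
    intro w hw
    obtain ⟨a, b, haW, ha, hbW, hb, rfl⟩ := bfba_graded_split μ W hgr ν hw
    exact Submodule.add_mem_sup ⟨haW, ha⟩ ⟨hbW, hb⟩
  have hinf : S₁ ⊓ S₂ = ⊥ := by
    rw [eq_bot_iff]
    rintro x ⟨⟨-, hx1⟩, ⟨-, hx2⟩⟩
    rw [Submodule.mem_bot]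
    exact bfba_eq_zero_of_mem_Fge_Flt μ hx1 hx2
  have h := Submodule.finrank_sup_add_finrank_inf_eq S₁ S₂
  rw [hinf, finrank_bot, add_zero, hsup] at h
  exact h.symm

/-! ## Lowering maps -/

/-- **Top weights survive a lowering map.**  If `Φ` is lowering, `Φ w ∈ F_{≥ν}` and all weights of
`w` are `< ν`, then `w = 0`: otherwise the top-weight coefficient of `w` is untouched by `Φ`, so
`Φ w` has a monomial of weight `< ν`. [folklore] -/
theorem bfba_eq_zero_of_lowering (Φ : MvPolynomial σ ℂ →ₗ[ℂ] MvPolynomial σ ℂ)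
    (hΦ : ∀ (ν : ℤ) (D : MvPolynomial σ ℂ), (∀ e ∈ D.support, Finsupp.weight μ e ≤ ν) →
      ∀ e ∈ (Φ D - D).support, Finsupp.weight μ e < ν)
    {ν : ℤ} {w : MvPolynomial σ ℂ} (hw : ∀ e ∈ w.support, Finsupp.weight μ e < ν)
    (hΦw : ∀ e ∈ (Φ w).support, ν ≤ Finsupp.weight μ e) : w = 0 := by
  by_contra h0
  have hne : (w.support.image (Finsupp.weight μ)).Nonempty :=
    Finset.Nonempty.image (Finset.nonempty_of_ne_empty (mt support_eq_empty.1 h0)) _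
  set νs := (w.support.image (Finsupp.weight μ)).max' hne with hνs
  obtain ⟨es, hes, hesw⟩ := Finset.mem_image.1 ((w.support.image (Finsupp.weight μ)).max'_mem hne)
  have hle : ∀ e ∈ w.support, Finsupp.weight μ e ≤ νs := fun e he =>
    Finset.le_max' _ _ (Finset.mem_image_of_mem _ he)
  have h1 := hΦ νs w hle
  have hnot : es ∉ (Φ w - w).support := by
    intro hmem
    have := h1 es hmem
    rw [hesw] at this
    exact lt_irrefl _ this
  have hcoeff : coeff es (Φ w) = coeff es w := by
    have h := notMem_support_iff.1 hnot
    rwa [coeff_sub, sub_eq_zero] at h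
  have hes' : es ∈ (Φ w).support := by
    rw [mem_support_iff, hcoeff]
    exact mem_support_iff.1 hes
  have h2 := hΦw es hes'
  have h3 := hw es hes
  rw [hesw] at h3
  omega

/-- A lowering map preserves `F_{<ν}`. [folklore] -/
theorem bfba_lowering_mem_Flt (Φ : MvPolynomial σ ℂ →ₗ[ℂ] MvPolynomial σ ℂ)
    (hΦ : ∀ (ν : ℤ) (D : MvPolynomial σ ℂ), (∀ e ∈ D.support, Finsupp.weight μ e ≤ ν) →
      ∀ e ∈ (Φ D - D).support, Finsupp.weight μ e < ν)
    {ν : ℤ} {l : MvPolynomial σ ℂ} (hl : l ∈ restrictSupport ℂ {e : σ →₀ ℕ | Finsupp.weight μ e < ν}) :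
    Φ l ∈ restrictSupport ℂ {e : σ →₀ ℕ | Finsupp.weight μ e < ν} := by
  have hl' := (bfba_mem_Flt μ).1 hl
  have h1 : Φ l - l ∈ restrictSupport ℂ {e : σ →₀ ℕ | Finsupp.weight μ e < ν} := by
    rw [bfba_mem_Flt]
    intro e he
    have := hΦ (ν - 1) l (fun e' he' => by have := hl' e' he'; omega) e he
    omega
  have h2 : Φ l = (Φ l - l) + l := by ring
  rw [h2]
  exact Submodule.add_mem _ h1 hl

section Ranks

variable [DecidableEq σ] (W : Submodule ℂ (MvPolynomial σ ℂ)) [FiniteDimensional ℂ W]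
  (hgr : ∀ D ∈ W, ∀ ν : ℤ, weightedHomogeneousComponent μ ν D ∈ W)
  (Φ : MvPolynomial σ ℂ →ₗ[ℂ] MvPolynomial σ ℂ) (hinj : Function.Injective Φ)
  (hΦ : ∀ (ν : ℤ) (D : MvPolynomial σ ℂ), (∀ e ∈ D.support, Finsupp.weight μ e ≤ ν) →
      ∀ e ∈ (Φ D - D).support, Finsupp.weight μ e < ν)

omit [DecidableEq σ] [FiniteDimensional ℂ W] in
include hinj in
/-- `Φ` maps `{w ∈ W : Φ w ∈ F_{≥ν}}` isomorphically onto `Φ W ∩ F_{≥ν}`. [folklore] -/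
theorem bfba_finrank_pullback (ν : ℤ) :
    Module.finrank ℂ ↥(W ⊓ (restrictSupport ℂ {e : σ →₀ ℕ | ν ≤ Finsupp.weight μ e}).comap Φ) =
      Module.finrank ℂ ↥(W.map Φ ⊓ restrictSupport ℂ {e : σ →₀ ℕ | ν ≤ Finsupp.weight μ e}) := by
  set S₁ := W ⊓ (restrictSupport ℂ {e : σ →₀ ℕ | ν ≤ Finsupp.weight μ e}).comap Φ with hS₁
  have hmap : S₁.map Φ = W.map Φ ⊓ restrictSupport ℂ {e : σ →₀ ℕ | ν ≤ Finsupp.weight μ e} := by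
    apply le_antisymm
    · rintro _ ⟨w, ⟨hwW, hwF⟩, rfl⟩
      exact ⟨Submodule.mem_map_of_mem hwW, hwF⟩
    · rintro x ⟨⟨w, hwW, rfl⟩, hxF⟩
      exact ⟨w, ⟨hwW, hxF⟩, rfl⟩
  rw [← hmap]
  exact LinearEquiv.finrank_eq (Submodule.equivMapOfInjective Φ hinj S₁)

include hgr hinj hΦ in
/-- **Rank inequality.**  For a `μ`-graded `W` and an injective lowering `Φ`:
`dim (Φ W ∩ F_{≥ν}) ≤ dim (W ∩ F_{≥ν})`.  The pull-back `{w ∈ W : Φ w ∈ F_{≥ν}}` meets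
`W ∩ F_{<ν}` trivially (`bfba_eq_zero_of_lowering`), and `W = (W ∩ F_{≥ν}) ⊕ (W ∩ F_{<ν})`.
[folklore] -/
theorem bfba_rank_le (ν : ℤ) :
    Module.finrank ℂ ↥(W.map Φ ⊓ restrictSupport ℂ {e : σ →₀ ℕ | ν ≤ Finsupp.weight μ e}) ≤
      Module.finrank ℂ ↥(W ⊓ restrictSupport ℂ {e : σ →₀ ℕ | ν ≤ Finsupp.weight μ e}) := by
  rw [← bfba_finrank_pullback μ W Φ hinj ν]
  have h3 := bfba_finrank_graded_split μ W hgr ν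
  set S₁ := W ⊓ (restrictSupport ℂ {e : σ →₀ ℕ | ν ≤ Finsupp.weight μ e}).comap Φ with hS₁
  set S₂ := W ⊓ restrictSupport ℂ {e : σ →₀ ℕ | Finsupp.weight μ e < ν} with hS₂
  have hinf : S₁ ⊓ S₂ = ⊥ := by
    rw [eq_bot_iff]
    rintro w ⟨⟨-, hw1⟩, ⟨-, hw2⟩⟩
    rw [Submodule.mem_bot]
    exact bfba_eq_zero_of_lowering μ Φ hΦ ((bfba_mem_Flt μ).1 hw2)
      ((bfba_mem_Fge μ).1 (Submodule.mem_comap.1 hw1))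
  have h1 := Submodule.finrank_sup_add_finrank_inf_eq S₁ S₂
  rw [hinf, finrank_bot, add_zero] at h1
  have h2 : Module.finrank ℂ ↥(S₁ ⊔ S₂) ≤ Module.finrank ℂ W :=
    Submodule.finrank_mono (sup_le inf_le_left inf_le_left)
  omega

include hgr hinj hΦ in
/-- **Equality of all ranks forces `Φ W = W`.**  If `dim (Φ W ∩ F_{≥ν}) = dim (W ∩ F_{≥ν})` for
every `ν` then `Φ W = W`: for a pure-weight-`ν` element `w ∈ W`, the dimension count gives
`w = w₁ + l` with `Φ w₁ ∈ F_{≥ν}`, `w₁ ∈ W`, `l ∈ W ∩ F_{<ν}`; then `Φ w₁ - w ∈ F_{≥ν} ∩ F_{<ν} = 0`,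
so `w = Φ w₁ ∈ Φ W`. [folklore] -/
theorem bfba_map_eq_of_rank_eq
    (heq : ∀ ν : ℤ,
      Module.finrank ℂ ↥(W.map Φ ⊓ restrictSupport ℂ {e : σ →₀ ℕ | ν ≤ Finsupp.weight μ e}) =
        Module.finrank ℂ ↥(W ⊓ restrictSupport ℂ {e : σ →₀ ℕ | ν ≤ Finsupp.weight μ e})) :
    W.map Φ = W := by
  -- pure pieces of `W` lie in `Φ W`
  have key : ∀ (ν : ℤ) (w : MvPolynomial σ ℂ), w ∈ W →
      w ∈ restrictSupport ℂ {e : σ →₀ ℕ | ν ≤ Finsupp.weight μ e} →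
      (∀ e ∈ w.support, Finsupp.weight μ e ≤ ν) → w ∈ W.map Φ := by
    intro ν w hwW hwge hwle
    have h3 := bfba_finrank_graded_split μ W hgr ν
    have h4 := bfba_finrank_pullback μ W Φ hinj ν
    have h5 := heq ν
    set S₁ := W ⊓ (restrictSupport ℂ {e : σ →₀ ℕ | ν ≤ Finsupp.weight μ e}).comap Φ with hS₁
    set S₂ := W ⊓ restrictSupport ℂ {e : σ →₀ ℕ | Finsupp.weight μ e < ν} with hS₂
    have hinf : S₁ ⊓ S₂ = ⊥ := by
      rw [eq_bot_iff]
      rintro w ⟨⟨-, hw1⟩, ⟨-, hw2⟩⟩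
      rw [Submodule.mem_bot]
      exact bfba_eq_zero_of_lowering μ Φ hΦ ((bfba_mem_Flt μ).1 hw2)
        ((bfba_mem_Fge μ).1 (Submodule.mem_comap.1 hw1))
    have hsup : S₁ ⊔ S₂ = W := by
      apply Submodule.eq_of_le_of_finrank_eq (sup_le inf_le_left inf_le_left)
      have h1 := Submodule.finrank_sup_add_finrank_inf_eq S₁ S₂
      rw [hinf, finrank_bot, add_zero] at h1
      omega
    have hw' : w ∈ S₁ ⊔ S₂ := hsup.symm ▸ hwW
    obtain ⟨w₁, hw₁, l, hl, hwl⟩ := Submodule.mem_sup.1 hw'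
    obtain ⟨hw₁W, hw₁F⟩ := hw₁
    obtain ⟨-, hlF⟩ := hl
    have hΦl : Φ l ∈ restrictSupport ℂ {e : σ →₀ ℕ | Finsupp.weight μ e < ν} :=
      bfba_lowering_mem_Flt μ Φ hΦ hlF
    have hdiff : Φ w - w ∈ restrictSupport ℂ {e : σ →₀ ℕ | Finsupp.weight μ e < ν} :=
      (bfba_mem_Flt μ).2 (hΦ ν w hwle)
    have hr : Φ w₁ - w ∈ restrictSupport ℂ {e : σ →₀ ℕ | Finsupp.weight μ e < ν} := by
      have : Φ w₁ - w = (Φ w - w) - Φ l := by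
        rw [← hwl, map_add]; ring
      rw [this]
      exact Submodule.sub_mem _ hdiff hΦl
    have hr' : Φ w₁ - w ∈ restrictSupport ℂ {e : σ →₀ ℕ | ν ≤ Finsupp.weight μ e} :=
      Submodule.sub_mem _ (Submodule.mem_comap.1 hw₁F) hwge
    have h0 := bfba_eq_zero_of_mem_Fge_Flt μ hr' hr
    rw [sub_eq_zero] at h0
    exact ⟨w₁, hw₁W, h0⟩
  -- hence `W ≤ Φ W`, and the dimensions agree
  have hle : W ≤ W.map Φ := by
    intro w hw
    rw [← cr_sum_comp (μ := μ) w]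
    refine Submodule.sum_mem _ fun ν' _ => key ν' _ (hgr w hw ν') (bfba_comp_mem_Fge μ le_rfl w) ?_
    intro e he
    rw [mem_support_iff, coeff_weightedHomogeneousComponent] at he
    split_ifs at he with hwt
    · exact hwt.le
    · exact absurd rfl he
  symm
  refine Submodule.eq_of_le_of_finrank_eq hle ?_
  exact (LinearEquiv.finrank_eq (Submodule.equivMapOfInjective Φ hinj W))

end Ranks

end Summit.ValiantsHypothesis.ValiantsHypothesis.Theorems.BorderApolarityBorelFixedBorderApolarity
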